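import Mathlib

/-!
# PP(12), family B1-p+: collineations of prime order `n + 1` — typed lift normal form, kernel control, census statement
Framing: lottery ticket; floor = certified bounds/negative ranges.

Companion of `OrderElevenCollineation.lean` (cell pub-namedobj, target M). A collineation `σ` of prime order
`p = n + 1` of a projective plane of order `n` fixes exactly an antiflag `(P₀, l₀)` (FAMILY-B1P-PLUS.md Lemma 5;
the fixed-line congruence is `FixedPointCongruences.fixedOnLine_order12_q13` for `n = 12`). With base choices
(a line `N` through `P₀`, `Q = N ∩ l₀`, `P_t = N ∩ T_t` on the `n − 1` free point orbits, base lines `L_s ∋ Q`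
of the `n − 1` free line orbits) the plane is encoded by the membership tables
`mem s t x ↔ P_t^{σ^x} ∈ L_s` (`x ∈ Z_p`, coded as `Fin p`), and "any two lines meet exactly once" becomes
`LiftData.Valid` below (FAMILY-B1P-PLUS §2). Here we

* define the normal form as a DECIDABLE predicate (the object `code/collin/liftplus.c|.py` exhaust, for every
  admissible orbit matrix);
* kernel-check the (+) control: the lift extracted from `PG(2,4)` with a collineation of order `5` fixing an
  antiflag is valid (`decide`);
* TYPE the census statement for `n = 12`, `p = 13` (`NoLiftData13`) — NOT proved in Lean: certified by
  exhaustive search (38 orbit-matrix classes, 0 lifts; designs E1 `liftplus.c`, twin `liftplus.py`, farm j098200)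
  and in print as Janko–van Trung, Geom. Dedicata 11 (1981) 257–284 and 12 (1982) 87–99.
-/

namespace Summit.Ventures.DiscreteObjects.PP12

/-- **Lift data** for the antiflag action of `Z_p` (`p = n + 1` prime) with `N = n − 1` free point orbits and
`N` free line orbits: `mem s t x` says that the base line of free line orbit `s` contains the point `P_t^{σ^x}`. -/
structure LiftData (N p : ℕ) where
  /-- membership table `x ∈ E_{s,t}` -/
  mem : Fin N → Fin N → Fin p → Bool

namespace LiftData

variable {N p : ℕ}

/-- (M·U) for each free line orbit `s`, the sets `E_{s,t}` partition `Z_p ∖ {0}`: a line through `P₀` meets a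
free line exactly once. -/
def RowPartition [NeZero p] (D : LiftData N p) (s : Fin N) : Prop :=
  (∀ t, D.mem s t 0 = false) ∧ ∀ x : Fin p, x ≠ 0 → ∃ t, D.mem s t x = true ∧ ∀ t', D.mem s t' x = true → t' = t

/-- (U·U, same orbit) internal differences within row `s` realise every non-zero residue exactly once: two lines
of the same free orbit meet exactly once. -/
def Internal [NeZero p] (D : LiftData N p) (s : Fin N) : Prop :=
  ∀ δ : Fin p, δ ≠ 0 → ∃ t x, D.mem s t x = true ∧ D.mem s t (x - δ) = true ∧
    ∀ t' x', D.mem s t' x' = true → D.mem s t' (x' - δ) = true → t' = t ∧ x' = x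

/-- (U·U′, different orbits) columnwise disjoint and every non-zero cross difference exactly once: lines of
different free orbits meet exactly once. -/
def Cross [NeZero p] (D : LiftData N p) (s s' : Fin N) : Prop :=
  (∀ t x, ¬ (D.mem s t x = true ∧ D.mem s' t x = true)) ∧
  ∀ δ : Fin p, δ ≠ 0 → ∃ t x, D.mem s t x = true ∧ D.mem s' t (x - δ) = true ∧
    ∀ t' x', D.mem s t' x' = true → D.mem s' t' (x' - δ) = true → t' = t ∧ x' = x

/-- **Lift normal form** (FAMILY-B1P-PLUS §2): all line pairs meet exactly once. -/
def Valid [NeZero p] (D : LiftData N p) : Prop :=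
  (∀ s, D.RowPartition s ∧ D.Internal s) ∧ ∀ s s', s ≠ s' → D.Cross s s'

/-- (M·U) is decidable. -/
instance [NeZero p] (D : LiftData N p) (s : Fin N) : Decidable (D.RowPartition s) := by
  unfold RowPartition; infer_instance
/-- (U·U) is decidable. -/
instance [NeZero p] (D : LiftData N p) (s : Fin N) : Decidable (D.Internal s) := by
  unfold Internal; infer_instance
/-- (U·U′) is decidable. -/
instance [NeZero p] (D : LiftData N p) (s s' : Fin N) : Decidable (D.Cross s s') := by
  unfold Cross; infer_instance
/-- `Valid` is decidable, so explicit lifts are checked by `decide`. -/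
instance [NeZero p] (D : LiftData N p) : Decidable D.Valid := by unfold Valid; infer_instance

end LiftData

/-- The lift extracted from `PG(2,4)` with a collineation `diag(1) ⊕ A` (`A ∈ GL(2,4)` of order 5) fixing exactly an
antiflag (census file `M-B1pp-lift-n4.sols.jsonl`, lift 1): rows `E_0 = ({1,4},{2,3},∅)`, `E_1 = ({2,3},∅,{1,4})`,
`E_2 = (∅,{1,4},{2,3})` over `Z_5`; orbit matrix `[[2,2,0],[2,0,2],[0,2,2]]`. -/
def pg4Lift : LiftData 3 5 where
  mem := fun s t x =>
    (decide (s = 0) && ((decide (t = 0) && (decide (x = 1) || decide (x = 4))) ||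
                        (decide (t = 1) && (decide (x = 2) || decide (x = 3))))) ||
    (decide (s = 1) && ((decide (t = 0) && (decide (x = 2) || decide (x = 3))) ||
                        (decide (t = 2) && (decide (x = 1) || decide (x = 4))))) ||
    (decide (s = 2) && ((decide (t = 1) && (decide (x = 1) || decide (x = 4))) ||
                        (decide (t = 2) && (decide (x = 2) || decide (x = 3)))))

/-- (+) control, kernel: the `PG(2,4)` antiflag lift is a valid normal form. -/
theorem pg4Lift_valid : pg4Lift.Valid := by
  decide

/-- **Census statement, `n = 12`, `p = 13` (typed only).** No lift data with `11` free orbits over `Z_13` are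
valid; equivalently (FAMILY-B1P-PLUS §1–§2) no projective plane of order 12 admits a collineation of order 13.
Certified by exhaustive search over the 38 admissible orbit-matrix classes (designs `omgen.c`, `liftplus.c`:
0 lifts, 44 s normalised / 282 s unnormalised; `liftplus.py` twin, farm j098200); in print: Janko–van Trung
1981/82. NOT proved here. -/
def NoLiftData13 : Prop := ∀ D : LiftData 11 13, ¬ D.Valid

end Summit.Ventures.DiscreteObjects.PP12
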